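import Summits.QuantumAdvantage.QuantumAdvantage.Theorems.CharDialExchangeBridge
import HarnessLib

/-!
# ExchangeClasses — law 2½ from "every relevant non-junta variable has p − 2 exchange partners" (kernel glue for L2G)

(decomp-qadv-lens-6 g8.)  Swap-invariance `i ~ j :⟺ ∀ u, f (u ∘ swap i j) = f u` is an equivalence relation on
coordinates (`swapInv_self/symm/conj`); its classes outside the junta `J` are the blocks of `law_of_exchangeable_blocks`.
Hence `SubChar.law_of_exchange_partners`: if every RELEVANT coordinate `i ∉ J` has at least `p − 1` coordinates
`j ∉ J` (itself included) with `i ~ j`, and `deg_p f ≤ p − 1`, then `f u = h(u_J, Σ cᵢuᵢ)`.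
So the lineage's law 2½ (`FrobStructureLaw`, junta bound `J₀`) is EXACTLY the statement
  L2G(p): ∃ E, ∀ n f, HasDegF p f (p − 1) → #{relevant i whose swap-class has ≤ p − 2 elements} ≤ E
(take `J` := that set; it is a union of classes, so every relevant `i ∉ J` keeps its ≥ p − 1 partners outside `J`).
-/

namespace Summit.QuantumAdvantage.AdviceFreeQNC0

namespace SubChar

open Finset
open Literature.Computability.MetaComplexity

variable {n : ℕ}

/-- CharDial sub-characteristic helper `swapInv_self` (lens-6 g8 LAND package; see the module docstring). -/
theorem swapInv_self (f : (Fin n → Bool) → Bool) (a : Fin n) : ∀ u : Fin n → Bool, f (u ∘ Equiv.swap a a) = f u := by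
  intro u
  rw [Equiv.swap_self]
  rfl

/-- CharDial sub-characteristic helper `swapInv_symm` (lens-6 g8 LAND package; see the module docstring). -/
theorem swapInv_symm (f : (Fin n → Bool) → Bool) {a b : Fin n} (h : ∀ u : Fin n → Bool, f (u ∘ Equiv.swap a b) = f u) :
    ∀ u : Fin n → Bool, f (u ∘ Equiv.swap b a) = f u := by
  intro u
  rw [Equiv.swap_comm]
  exact h u

/-- Conjugation: invariance under `swap a b` and `swap a c` gives invariance under `swap b c`. -/
theorem swapInv_conj (f : (Fin n → Bool) → Bool) {a b c : Fin n}
    (hab : ∀ u : Fin n → Bool, f (u ∘ Equiv.swap a b) = f u) (hac : ∀ u : Fin n → Bool, f (u ∘ Equiv.swap a c) = f u) :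
    ∀ u : Fin n → Bool, f (u ∘ Equiv.swap b c) = f u := by
  intro u
  by_cases hbc : b = c
  · rw [hbc]; exact swapInv_self f c u
  by_cases hba : b = a
  · rw [hba]; exact hac u
  by_cases hca : c = a
  · rw [hca]; exact swapInv_symm f hab u
  have key : Equiv.swap b c = Equiv.swap a b * Equiv.swap a c * Equiv.swap a b := by
    have h := Equiv.swap_apply_apply (Equiv.swap a b) a c
    rw [Equiv.swap_apply_left, Equiv.swap_apply_of_ne_of_ne hca (Ne.symm hbc), Equiv.swap_inv] at h
    exact h
  rw [key, Equiv.Perm.coe_mul, Equiv.Perm.coe_mul, ← Function.comp_assoc, ← Function.comp_assoc, hab, hac, hab]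

/-- **Law 2½ from exchange partners.**  If every relevant coordinate outside `J` has `≥ p − 1` swap-partners outside `J`
(itself included) and `deg_p f ≤ p − 1`, then `f u = h(u_J, Σ cᵢ uᵢ)`. -/
theorem law_of_exchange_partners (p : ℕ) [Fact p.Prime] (J : Finset (Fin n)) (f : (Fin n → Bool) → Bool)
    (hbig : ∀ i, i ∉ J → (∃ (u : Fin n → Bool) (b : Bool), f (Function.update u i b) ≠ f u) →
      p - 1 ≤ (Finset.univ.filter fun j => j ∉ J ∧ ∀ u : Fin n → Bool, f (u ∘ Equiv.swap i j) = f u).card)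
    (hf : HasDegF p f (p - 1)) :
    ∃ (c : Fin n → ZMod p) (h : (Fin n → Bool) → ZMod p → Bool), ∀ u,
      f u = h (JLin.proj J u) (∑ i, if u i then c i else 0) := by
  -- the swap-classes outside `J`
  let K : Fin n → Finset (Fin n) := fun i =>
    Finset.univ.filter fun j => j ∉ J ∧ ∀ u : Fin n → Bool, f (u ∘ Equiv.swap i j) = f u
  have hKmem : ∀ i j, j ∈ K i ↔ (j ∉ J ∧ ∀ u : Fin n → Bool, f (u ∘ Equiv.swap i j) = f u) := by
    intro i j
    show j ∈ Finset.univ.filter (fun j => j ∉ J ∧ ∀ u : Fin n → Bool, f (u ∘ Equiv.swap i j) = f u) ↔ _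
    rw [mem_filter]
    exact ⟨fun h => h.2, fun h => ⟨mem_univ j, h⟩⟩
  have hKJ : ∀ i, Disjoint J (K i) := fun i => disjoint_right.2 fun j hj => ((hKmem i j).1 hj).1
  have hK_self : ∀ i, i ∉ J → i ∈ K i := fun i hi => (hKmem i i).2 ⟨hi, swapInv_self f i⟩
  have hK_swap : ∀ i, ∀ j ∈ K i, ∀ j' ∈ K i, ∀ u : Fin n → Bool, f (u ∘ Equiv.swap j j') = f u :=
    fun i j hj j' hj' => swapInv_conj f ((hKmem i j).1 hj).2 ((hKmem i j').1 hj').2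
  have hK_eq : ∀ i i' k, k ∈ K i → k ∈ K i' → K i = K i' := by
    intro i i' k hk hk'
    have hii' : ∀ u : Fin n → Bool, f (u ∘ Equiv.swap i i') = f u :=
      swapInv_conj f (swapInv_symm f ((hKmem i k).1 hk).2) (swapInv_symm f ((hKmem i' k).1 hk').2)
    ext j
    rw [hKmem, hKmem]
    exact ⟨fun h => ⟨h.1, swapInv_conj f hii' h.2⟩, fun h => ⟨h.1, swapInv_conj f (swapInv_symm f hii') h.2⟩⟩
  -- the relevant non-junta coordinates and the finite family of their classes
  let R : Finset (Fin n) :=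
    Finset.univ.filter fun i => i ∉ J ∧ ∃ (u : Fin n → Bool) (b : Bool), f (Function.update u i b) ≠ f u
  have hRmem : ∀ i, i ∈ R ↔ (i ∉ J ∧ ∃ (u : Fin n → Bool) (b : Bool), f (Function.update u i b) ≠ f u) := by
    intro i
    show i ∈ Finset.univ.filter (fun i => i ∉ J ∧ ∃ (u : Fin n → Bool) (b : Bool), f (Function.update u i b) ≠ f u) ↔ _
    rw [mem_filter]
    exact ⟨fun h => h.2, fun h => ⟨mem_univ i, h⟩⟩
  let ℬ : Finset (Finset (Fin n)) := R.image K
  let A : Fin ℬ.card → Finset (Fin n) := fun j => (ℬ.equivFin.symm j).1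
  have hAmem : ∀ j, A j ∈ ℬ := fun j => (ℬ.equivFin.symm j).2
  have hAinj : ∀ j j', A j = A j' → j = j' := fun j j' h =>
    ℬ.equivFin.symm.injective (Subtype.ext h)
  have hAsurj : ∀ B ∈ ℬ, ∃ j, A j = B := fun B hB =>
    ⟨ℬ.equivFin ⟨B, hB⟩, by
      show (ℬ.equivFin.symm (ℬ.equivFin ⟨B, hB⟩)).1 = B
      rw [Equiv.symm_apply_apply]⟩
  have hAK : ∀ j, ∃ i ∈ R, A j = K i := by
    intro j
    obtain ⟨i, hi, hiK⟩ := mem_image.1 (hAmem j)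
    exact ⟨i, hi, hiK.symm⟩
  refine law_of_exchangeable_blocks p A ?_ ?_ J ?_ f ?_ ?_ hf
  · intro j j' hjj'
    obtain ⟨i, -, hi⟩ := hAK j
    obtain ⟨i', -, hi'⟩ := hAK j'
    rw [hi, hi', Finset.disjoint_left]
    intro k hk hk'
    exact hjj' (hAinj j j' (by rw [hi, hi']; exact hK_eq i i' k hk hk'))
  · intro j
    obtain ⟨i, hiR, hi⟩ := hAK j
    rw [hi]
    have hiR' := (hRmem i).1 hiR
    exact hbig i hiR'.1 hiR'.2
  · intro j
    obtain ⟨i, -, hi⟩ := hAK j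
    rw [hi]
    exact hKJ i
  · intro u j i1 hi1 i2 hi2
    obtain ⟨i, -, hi⟩ := hAK j
    rw [hi] at hi1 hi2
    exact hK_swap i i1 hi1 i2 hi2 u
  · intro u k hkJ hkA b
    by_contra hne
    have hkR : k ∈ R := (hRmem k).2 ⟨hkJ, u, b, hne⟩
    obtain ⟨j, hj⟩ := hAsurj (K k) (mem_image_of_mem K hkR)
    exact hkA j (by rw [hj]; exact hK_self k hkJ)

end SubChar

end Summit.QuantumAdvantage.AdviceFreeQNC0
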